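import Mathlib
import Summits.Ventures.CertifiedArithmetic.LowPrec.OptW11ViolationBlock

/-!
# Opt / S15(i) — W11 window optimality for blocks of `k ≤ 27` elements: the reflective cell-certificate checker (part 1 of 4)

HONEST FRAMING (venture CertifiedArithmetic / cell `pub-lowprec`, seat OPT, gen 19): certified error
envelopes and provably optimal rounding/accumulation schemes for low-precision formats under stated
cost models; every table by two implementations; no hardware or vendor claims.

SETTING (as `OptW11ViolationBlock`, `OptFourOverSixRatio`): E2M1 elements with saturating round-to-nearest,
element error `err e2m1Lo_ne s y` = distance from `y` to the value grid `s · {0,1,2,3,4,6,8,12}` (`s = X/2` for the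
block scale `X`), block objective `blockSSE e2m1Lo_ne s x = ∑ i, err s (x i)²`; scales on the E4M3-type grid
`X = M · 2^e`, `8 ≤ M ≤ 15` (`IsMant3Scale`), indexed here by a RELATIVE CODE INDEX `r : ℕ` with
`64 · s(r) = w11sY r = (8 + r % 8) · 2^(r/8 + 1)`.  A CLASS `m ∈ {0,…,7}` is the set of blocks whose maximum `a`
satisfies `6 X(m+15) < a ≤ 6 X(m+16)` (the non-clipping code `c_nc` has relative index `m + 16`; every block with a
positive maximum is brought into a class by a power-of-two rescaling, part 4); the W11 WINDOW of the class is the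
eleven codes of relative index `m+12, …, m+22` (`c_nc - 4, …, c_nc + 6`).

THIS FILE (data + checker, no theorems): OPT g18 proved Theorem S15(i) of `OPTIMA.md` — for every block of
`k ≤ 27` elements the W11 window contains a block-SSE-optimal scale of the grid — by 96 exact-rational LP dual
certificates (8 classes × the 12 competitor offsets `-16 … -5`; every other offset is dominated structurally,
part 4).  Such a certificate is the INTEGER object `W11Cert` = (class `m`, offset `-d`, window weights `lam`
with the common denominator `L` cleared, margin `Z`).  `W11Cert.check N` (pure `ℕ/ℤ`, run by `decide +kernel`
in part 3) rebuilds the pieces of `[0, 6 X(c_nc)]` cut at every kink of the twelve error functions (units of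
`1/64`), anchors on each piece an UPPER bound of every window error (nearest grid point) and a LOWER bound of the
competitor's error (two adjacent grid points or the top), verifies the anchors' validity, and checks the affine
integer inequalities `∑_w lam_w ((Y - G_w)² - (Y - H)²) ≤ 4096 L` (helper pieces) and
`∑_w lam_w ((A - 12 s_t)² - (A - G_w)²) ≥ Z` (pieces of the class interval of the maximum) at both ends of every
piece, the two coverings, and `N · 4096 · L < Z`.  Soundness (`check N = true` ⟹ the cell statement
`W11CellWin`) is part 2 (`OptW11CertSound`).  Generator and exact replay of every check:
`pub-lowprec-opt/gen19/s15lean/w11cert_gen2.py`.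
-/

namespace Summit.Ventures.CertifiedArithmetic.LowPrec.Opt

/-- `64 · s(r)` for the scale of relative code index `r`: `(8 + r % 8) · 2^(r/8 + 1)` -/
def w11sY (r : ℕ) : ℕ := (8 + r % 8) * 2 ^ (r / 8 + 1)

/-- anchor for a LOWER bound of the competitor's error on a piece: between the adjacent grid multipliers
`n < n'` (nearer to `n`: `lower`, nearer to `n'`: `upper`), or above the top grid point `12 s` -/
inductive W11TA
  | lower (n n' : ℕ)
  | upper (n n' : ℕ)
  | top

/-- a piece `[lo, hi]` (units of `1/64`) of the helper range with its competitor anchor and, for each of the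
11 window codes, the grid multiplier anchoring the UPPER bound of that code's error -/
structure W11GPiece where
  /-- left end -/
  lo : ℕ
  /-- right end -/
  hi : ℕ
  /-- competitor anchor -/
  ta : W11TA
  /-- window anchors -/
  ca : Fin 11 → ℕ

/-- a piece `[lo, hi]` (units of `1/64`) of the class interval of the block maximum, with window anchors -/
structure W11RPiece where
  /-- left end -/
  lo : ℕ
  /-- right end -/
  hi : ℕ
  /-- window anchors -/
  ca : Fin 11 → ℕ

/-- an integer W11 cell certificate: class `m`, competitor offset `-d`, window weights `lam` (offsets
`-4, …, +6` in this order; common denominator `L` cleared), margin `Z` -/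
structure W11Cert where
  /-- class -/
  m : ℕ
  /-- the competitor has offset `-d` from `c_nc` -/
  d : ℕ
  /-- integer window weights -/
  lam : Fin 11 → ℕ
  /-- common denominator -/
  L : ℕ
  /-- margin -/
  Z : ℕ

namespace W11Cert

/-! ### list utilities (structural recursion only, for kernel evaluation) -/

/-- sum of eleven integers (kernel-friendly form of `∑ w : Fin 11`) -/
def sum11 (g : Fin 11 → ℤ) : ℤ := (List.ofFn g).sum

/-- ordered insertion -/
def ins (a : ℕ) : List ℕ → List ℕ
  | [] => [a]
  | b :: l => if a ≤ b then a :: b :: l else b :: ins a l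

/-- insertion sort -/
def isort : List ℕ → List ℕ
  | [] => []
  | a :: l => ins a (isort l)

/-- consecutive pairs -/
def pairs : List ℕ → List (ℕ × ℕ)
  | [] => []
  | a :: l =>
    match l with
    | [] => []
    | b :: _ => (a, b) :: pairs l

/-! ### scales, kinks and anchors -/

/-- `64 ·` the competitor's scale -/
def st (c : W11Cert) : ℕ := w11sY (c.m + 16 - c.d)

/-- `64 ·` the scale of window code `w` (relative index `m + 12 + w`, offset `w - 4` from `c_nc`) -/
def sw (c : W11Cert) (w : Fin 11) : ℕ := w11sY (c.m + w + 12)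

/-- `64 ·` the top of the class interval, `6 X(c_nc)` -/
def hiY (c : W11Cert) : ℕ := 12 * w11sY (c.m + 16)

/-- `64 ·` the bottom of the class interval, `6 X(c_nc - 1)` -/
def loY (c : W11Cert) : ℕ := 12 * w11sY (c.m + 15)

/-- the kinks (grid points and their midpoints, units of `1/64`) of the error function of a code with
`64 s = S` (`S` is even): `(S/2) · {0,1,…,8,10,12,14,16,20,24}` -/
def kinkList (S : ℕ) : List ℕ :=
  [0, S / 2, S / 2 * 2, S / 2 * 3, S / 2 * 4, S / 2 * 5, S / 2 * 6, S / 2 * 7, S / 2 * 8, S / 2 * 10,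
    S / 2 * 12, S / 2 * 14, S / 2 * 16, S / 2 * 20, S / 2 * 24]

/-- all kinks of the competitor and the eleven window codes -/
def kinks (c : W11Cert) : List ℕ := kinkList c.st ++ (List.ofFn fun w : Fin 11 => kinkList (c.sw w)).flatten

/-- competitor anchor chosen by the doubled midpoint `M2 = lo + hi` of a piece (validity is CHECKED, `taOK`) -/
def tAnc (S M2 : ℕ) : W11TA :=
  if M2 ≤ 2 * S then (if M2 ≤ S then .lower 0 1 else .upper 0 1)
  else if M2 ≤ 4 * S then (if M2 ≤ 3 * S then .lower 1 2 else .upper 1 2)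
  else if M2 ≤ 6 * S then (if M2 ≤ 5 * S then .lower 2 3 else .upper 2 3)
  else if M2 ≤ 8 * S then (if M2 ≤ 7 * S then .lower 3 4 else .upper 3 4)
  else if M2 ≤ 12 * S then (if M2 ≤ 10 * S then .lower 4 6 else .upper 4 6)
  else if M2 ≤ 16 * S then (if M2 ≤ 14 * S then .lower 6 8 else .upper 6 8)
  else if M2 ≤ 24 * S then (if M2 ≤ 20 * S then .lower 8 12 else .upper 8 12)
  else .top

/-- window anchor (a grid multiplier nearest to the midpoint) chosen by the doubled midpoint `M2` -/
def cAnc (S M2 : ℕ) : ℕ :=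
  if M2 ≤ S then 0 else if M2 ≤ 3 * S then 1 else if M2 ≤ 5 * S then 2 else if M2 ≤ 7 * S then 3
  else if M2 ≤ 10 * S then 4 else if M2 ≤ 14 * S then 6 else if M2 ≤ 20 * S then 8 else 12

/-- the helper pieces: consecutive kinks in `[0, 6 X(c_nc)]`, anchored at their midpoints -/
def gp (c : W11Cert) : List W11GPiece :=
  (pairs (isort (c.hiY :: (c.kinks.filter fun Y => decide (Y ≤ c.hiY))))).map fun ab =>
    ⟨ab.1, ab.2, tAnc c.st (ab.1 + ab.2), fun w => cAnc (c.sw w) (ab.1 + ab.2)⟩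

/-- the maximum pieces: consecutive kinks in the class interval `[6 X(c_nc - 1), 6 X(c_nc)]` -/
def rp (c : W11Cert) : List W11RPiece :=
  (pairs (isort (c.loY :: c.hiY :: (c.kinks.filter fun Y => decide (c.loY ≤ Y ∧ Y ≤ c.hiY))))).map fun ab =>
    ⟨ab.1, ab.2, fun w => cAnc (c.sw w) (ab.1 + ab.2)⟩

/-! ### the checks -/

/-- `n < n'` are ADJACENT multipliers of the E2M1 grid -/
def adjOK (n n' : ℕ) : Bool := [(0, 1), (1, 2), (2, 3), (3, 4), (4, 6), (6, 8), (8, 12)].elem (n, n')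

/-- validity of a competitor anchor on `[lo, hi]` at competitor scale `S = 64 s_t` -/
def taOK (S lo hi : ℕ) : W11TA → Bool
  | .lower n n' => adjOK n n' && decide (S * n ≤ lo) && decide (2 * hi ≤ S * (n + n'))
  | .upper n n' => adjOK n n' && decide (S * (n + n') ≤ 2 * lo) && decide (hi ≤ S * n')
  | .top => decide (12 * S ≤ lo)

/-- the anchor point `H` (units of `1/64`) of a competitor anchor -/
def taH (S : ℕ) : W11TA → ℕ
  | .lower n _ => S * n
  | .upper _ n' => S * n'
  | .top => 12 * S

/-- one term of the helper functional at `Y`: `lam_w ((Y - G_w)² - (Y - H)²)` -/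
def gterm (c : W11Cert) (p : W11GPiece) (Y : ℤ) (w : Fin 11) : ℤ :=
  (c.lam w : ℤ) * ((Y - (c.sw w * p.ca w : ℕ)) * (Y - (c.sw w * p.ca w : ℕ)) -
    (Y - (taH c.st p.ta : ℕ)) * (Y - (taH c.st p.ta : ℕ)))

/-- the helper functional at `Y` -/
def gval (c : W11Cert) (p : W11GPiece) (Y : ℤ) : ℤ := sum11 (c.gterm p Y)

/-- one term of the maximum functional at `A`: `lam_w ((A - 12 s_t)² - (A - G_w)²)` -/
def rterm (c : W11Cert) (p : W11RPiece) (A : ℤ) (w : Fin 11) : ℤ :=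
  (c.lam w : ℤ) * ((A - (12 * c.st : ℕ)) * (A - (12 * c.st : ℕ)) -
    (A - (c.sw w * p.ca w : ℕ)) * (A - (c.sw w * p.ca w : ℕ)))

/-- the maximum functional at `A` -/
def rval (c : W11Cert) (p : W11RPiece) (A : ℤ) : ℤ := sum11 (c.rterm p A)

/-- a helper piece passes: valid competitor anchor and the functional is `≤ 4096 L` at both ends -/
def gOK (c : W11Cert) (p : W11GPiece) : Bool :=
  taOK c.st p.lo p.hi p.ta && decide (c.gval p p.lo ≤ 4096 * c.L) && decide (c.gval p p.hi ≤ 4096 * c.L)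

/-- a maximum piece passes: above the competitor's top grid point and the functional is `≥ Z` at both ends -/
def rOK (c : W11Cert) (p : W11RPiece) : Bool :=
  decide (12 * c.st ≤ p.lo) && decide ((c.Z : ℤ) ≤ c.rval p p.lo) && decide ((c.Z : ℤ) ≤ c.rval p p.hi)

/-- the intervals `(a, b)` of the list, in order, chain from `u` to (at least) `v` -/
def covers : ℕ → ℕ → List (ℕ × ℕ) → Bool
  | _, _, [] => false
  | u, v, (a, b) :: ps => decide (a ≤ u) && (decide (v ≤ b) || covers b v ps)

/-- THE CHECKER: all pieces pass, the helper pieces cover `[0, 6 X(c_nc)]`, the maximum pieces cover the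
class interval, and the margin beats `N` helpers: `N · 4096 · L < Z` -/
def check (c : W11Cert) (N : ℕ) : Bool :=
  c.gp.all c.gOK && c.rp.all c.rOK &&
    covers 0 c.hiY (c.gp.map fun p => (p.lo, p.hi)) &&
    covers c.loY c.hiY (c.rp.map fun p => (p.lo, p.hi)) &&
    decide (N * 4096 * c.L < c.Z)

end W11Cert

/-! ### arithmetic of the relative code index (used by the assembly, part 4) -/

/-- one binade up doubles the scale -/
theorem w11sY_add_eight (r : ℕ) : w11sY (r + 8) = 2 * w11sY r := by
  have h1 : (r + 8) % 8 = r % 8 := by omega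
  have h2 : (r + 8) / 8 = r / 8 + 1 := by omega
  simp only [w11sY, h1, h2, pow_succ]
  ring

/-- `q` binades up multiplies the scale by `2^q` -/
theorem w11sY_add_mul_eight (r q : ℕ) : w11sY (r + 8 * q) = 2 ^ q * w11sY r := by
  induction q with
  | zero => simp
  | succ q ih =>
      rw [show r + 8 * (q + 1) = (r + 8 * q) + 8 by ring, w11sY_add_eight, ih, pow_succ]
      ring

/-- the index enumerates the grid scales increasingly -/
theorem w11sY_lt_succ (r : ℕ) : w11sY r < w11sY (r + 1) := by
  obtain ⟨q, j, hj, rfl⟩ : ∃ q j, j < 8 ∧ r = 8 * q + j :=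
    ⟨r / 8, r % 8, Nat.mod_lt _ (by norm_num), (Nat.div_add_mod r 8).symm⟩
  have h1 : (8 * q + j) % 8 = j := by omega
  have h2 : (8 * q + j) / 8 = q := by omega
  have hp : 0 < 2 ^ (q + 1) := by positivity
  by_cases hj7 : j = 7
  · subst hj7
    have h3 : (8 * q + 7 + 1) % 8 = 0 := by omega
    have h4 : (8 * q + 7 + 1) / 8 = q + 1 := by omega
    simp only [w11sY, h1, h2, h3, h4, pow_succ] at hp ⊢
    omega
  · have h3 : (8 * q + j + 1) % 8 = j + 1 := by omega
    have h4 : (8 * q + j + 1) / 8 = q := by omega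
    simp only [w11sY, h3, h4, h1, h2]
    exact Nat.mul_lt_mul_of_pos_right (by omega) hp

/-- monotonicity of the scale in the index -/
theorem w11sY_mono : Monotone w11sY := monotone_nat_of_le_succ fun r => (w11sY_lt_succ r).le

/-- the scales are positive -/
theorem w11sY_pos (r : ℕ) : 0 < w11sY r := by
  unfold w11sY; positivity

/-- numerical facts of the classes `m ≤ 7`: `16/3 · X_nc < 6 X(c_nc - 1)`, `6 X_nc ≤ 7 X(c_nc - 1)`, and the
normalised `64 ≤ w11sY (m + 16)` -/
theorem w11_class_facts {m : ℕ} (hm : m ≤ 7) : 8 * w11sY (m + 16) ≤ 9 * w11sY (m + 15) ∧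
    12 * w11sY (m + 16) ≤ 14 * w11sY (m + 15) ∧ 64 ≤ w11sY (m + 16) := by
  interval_cases m <;> decide

end Summit.Ventures.CertifiedArithmetic.LowPrec.Opt
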